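import Mathlib
import Summits.CriticalPhenomena.Ising3DConformalLimit.Theorems.HarmonicMomentsIsotropyHarmonicDilutionSymmetric
import HarnessLib

/-!
# Route HarmonicMomentsIsotropy — hyperoctahedral symmetrisation of harmonic quartics

Algebraic half of the degree-4 analysis of item `stmt-CriticalPhenomena-6034`
(`HarmonicDilution`); the moment identities and the reduction of the item's quartic slice to the
`K₄` family are in `HarmonicMomentsIsotropyHarmonicDilutionQuartic.lean`.

For a homogeneous quartic `Y ∈ ℝ[X₀,X₁,X₂]` write `c_A(Y) = Y_{(4,0,0)} + Y_{(0,4,0)} + Y_{(0,0,4)}`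
and `c_B(Y) = Y_{(2,2,0)} + Y_{(2,0,2)} + Y_{(0,2,2)}`.  Main results:

* `sum_signs_eval_of_degree_four`: the sign sum `∑_{ε ∈ {±1}³} Y(ε w)` keeps only the six even
  monomials (from the fifteen quartic sign sums, `prod_signs_of_sum_four`);
* `quartic_trace_of_harmonic`: `ΔY = 0` forces `3 c_A + c_B = 0` (coefficients of `xᵢ²` in `ΔY`,
  via `MvPolynomial.coeff_pderiv`);
* `sum_perm_pow_four`, `sum_perm_sq_sq`: `∑_{π ∈ S₃} v_{π⁻¹0}⁴ = 2∑vᵢ⁴` and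
  `∑_{π ∈ S₃} v_{π⁻¹0}² v_{π⁻¹1}² = (∑vᵢ²)² - ∑vᵢ⁴` (by reindexing, no enumeration of `S₃`);
* `symmetrization_of_degree_four`: for harmonic homogeneous quartic `Y`,
  `∑_{g ∈ B₃} Y(g v) = 40 c_A(Y) K₄(v)`, `K₄(v) = ∑ vᵢ⁴ - (3/5)(∑ vᵢ²)²`, the sum running over the
  `48` signed coordinate permutations `g = (π, ε)`, `(g v)ᵢ = εᵢ v_{π⁻¹ i}`;
* `K4poly_isHomogeneous`, `K4poly_harmonic`, `eval_K4poly`, `K4_signedPerm`: the cubic harmonic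
  `K₄ = ∑ Xᵢ⁴ - C(3/5)(∑ Xᵢ²)²` is homogeneous of degree `4`, harmonic
  (`Δ∑xᵢ⁴ = 12|x|²`, `Δ|x|⁴ = 20|x|²`), evaluates to `K₄(v)`, and is `B₃`-invariant.

Classical facts (the space of `B₃`-invariant harmonic quartics is the line `ℝ K₄`); elementary
proofs, stated in the vocabulary of the route decl (`MvPolynomial (Fin 3) ℝ`, `pderiv`,
`Equiv.Perm (Fin 3) × (Fin 3 → ℤˣ)` as in `harmonicMoment_eq_zero_of_symmetrization`).
-/

namespace Summit.CriticalPhenomena.Ising3DConformalLimit.Theorems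

open Filter Topology Set
open Literature.Probability.LatticeModels
open Summit.CriticalPhenomena.Ising3DConformalLimit.Theses.HarmonicMomentsIsotropy

/-! ### Sign sums of quartic monomials -/

/-- The sign sums of the fifteen quartic monomials in three variables: only the even exponent
patterns `(4,0,0)` and `(2,2,0)` (up to order) survive, each with the factor `8`. -/
theorem prod_signs_of_sum_four {a b c : ℕ} (h : a + b + c = 4) (x y z : ℝ) :
    (x ^ a + (-x) ^ a) * (y ^ b + (-y) ^ b) * (z ^ c + (-z) ^ c) =
      8 * ((if a = 4 then x ^ 4 else 0) + (if b = 4 then y ^ 4 else 0) +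
        (if c = 4 then z ^ 4 else 0) + (if a = 2 ∧ b = 2 then x ^ 2 * y ^ 2 else 0) +
        (if a = 2 ∧ c = 2 then x ^ 2 * z ^ 2 else 0) +
        (if b = 2 ∧ c = 2 then y ^ 2 * z ^ 2 else 0)) := by
  have ha : a ≤ 4 := by omega
  have hb : b ≤ 4 := by omega
  have hc : c ≤ 4 := by omega
  interval_cases a <;> interval_cases b <;> interval_cases c <;> first | omega | (simp <;> ring)

/-- A quartic exponent vector with an entry `4` is `4 eⱼ`. -/
theorem eq_single_four_iff {d : Fin 3 →₀ ℕ} (hd : d 0 + d 1 + d 2 = 4) (j : Fin 3) :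
    d = Finsupp.single j 4 ↔ d j = 4 := by
  constructor
  · rintro rfl; exact Finsupp.single_eq_same
  · intro hj
    ext i
    by_cases hij : i = j
    · subst hij; rw [Finsupp.single_eq_same, hj]
    · rw [Finsupp.single_eq_of_ne hij]
      fin_cases j <;> fin_cases i <;> simp at hij hj ⊢ <;> omega

/-- A quartic exponent vector with two entries `2` at `i ≠ j` is `2 eᵢ + 2 eⱼ`. -/
theorem eq_two_two_iff {d : Fin 3 →₀ ℕ} (hd : d 0 + d 1 + d 2 = 4) {i j : Fin 3} (hij : i ≠ j) :
    d = Finsupp.single i 2 + Finsupp.single j 2 ↔ d i = 2 ∧ d j = 2 := by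
  constructor
  · rintro rfl
    refine ⟨?_, ?_⟩
    · rw [Finsupp.add_apply, Finsupp.single_eq_same, Finsupp.single_apply, if_neg hij.symm,
        add_zero]
    · rw [Finsupp.add_apply, Finsupp.single_eq_same, Finsupp.single_apply, if_neg hij, zero_add]
  · rintro ⟨hi, hj⟩
    ext k
    rw [Finsupp.add_apply]
    fin_cases i <;> fin_cases j <;> fin_cases k <;> simp at hij hi hj ⊢ <;> omega

/-- `∑_{d ∈ supp Y} Y_d · (if d = d₀ then c else 0) = Y_{d₀} · c`. -/
theorem sum_coeff_mul_ite (Y : MvPolynomial (Fin 3) ℝ) (d₀ : Fin 3 →₀ ℕ) (c : ℝ) :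
    ∑ d ∈ Y.support, Y.coeff d * (if d = d₀ then c else 0) = Y.coeff d₀ * c := by
  simp_rw [mul_ite, mul_zero]
  rw [Finset.sum_ite_eq']
  split_ifs with h
  · rfl
  · rw [MvPolynomial.notMem_support_iff.1 h, zero_mul]

/-- For `Y` homogeneous of degree `4`: the sign sum `∑_ε Y(ε w)` only sees the six even
coefficients `Y_{4eᵢ}`, `Y_{2eᵢ+2eⱼ}`. -/
theorem sum_signs_eval_of_degree_four (Y : MvPolynomial (Fin 3) ℝ) (hY : Y.IsHomogeneous 4)
    (w : Fin 3 → ℝ) :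
    ∑ ε : Fin 3 → ℤˣ, MvPolynomial.eval (fun i => ((ε i : ℤ) : ℝ) * w i) Y =
      8 * (Y.coeff (Finsupp.single 0 4) * w 0 ^ 4 + Y.coeff (Finsupp.single 1 4) * w 1 ^ 4 +
        Y.coeff (Finsupp.single 2 4) * w 2 ^ 4 +
        Y.coeff (Finsupp.single 0 2 + Finsupp.single 1 2) * (w 0 ^ 2 * w 1 ^ 2) +
        Y.coeff (Finsupp.single 0 2 + Finsupp.single 2 2) * (w 0 ^ 2 * w 2 ^ 2) +
        Y.coeff (Finsupp.single 1 2 + Finsupp.single 2 2) * (w 1 ^ 2 * w 2 ^ 2)) := by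
  rw [sum_signs_eval]
  have hdeg : ∀ d ∈ Y.support, d 0 + d 1 + d 2 = 4 := by
    intro d hd
    have h := hY.degree_eq_sum_deg_support hd
    rw [← Finsupp.degree_apply, Finsupp.degree_eq_sum, Fin.sum_univ_three] at h
    omega
  have hG : ∀ d ∈ Y.support, ∏ i : Fin 3, (w i ^ d i + (-w i) ^ d i) =
      8 * ((if d = Finsupp.single 0 4 then w 0 ^ 4 else 0) +
        (if d = Finsupp.single 1 4 then w 1 ^ 4 else 0) +
        (if d = Finsupp.single 2 4 then w 2 ^ 4 else 0) +
        (if d = Finsupp.single 0 2 + Finsupp.single 1 2 then w 0 ^ 2 * w 1 ^ 2 else 0) +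
        (if d = Finsupp.single 0 2 + Finsupp.single 2 2 then w 0 ^ 2 * w 2 ^ 2 else 0) +
        (if d = Finsupp.single 1 2 + Finsupp.single 2 2 then w 1 ^ 2 * w 2 ^ 2 else 0)) := by
    intro d hd
    rw [Fin.prod_univ_three, prod_signs_of_sum_four (hdeg d hd)]
    simp only [eq_single_four_iff (hdeg d hd),
      eq_two_two_iff (hdeg d hd) (show (0 : Fin 3) ≠ 1 by decide),
      eq_two_two_iff (hdeg d hd) (show (0 : Fin 3) ≠ 2 by decide),
      eq_two_two_iff (hdeg d hd) (show (1 : Fin 3) ≠ 2 by decide)]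
  rw [Finset.sum_congr rfl fun d hd => by rw [hG d hd]]
  simp only [mul_add, Finset.sum_add_distrib]
  have h8 : ∀ (d₀ : Fin 3 →₀ ℕ) (c : ℝ),
      ∑ d ∈ Y.support, Y.coeff d * (8 * (if d = d₀ then c else 0)) = 8 * (Y.coeff d₀ * c) := by
    intro d₀ c
    rw [← sum_coeff_mul_ite Y d₀ c, Finset.mul_sum]
    refine Finset.sum_congr rfl fun d _ => ?_
    ring
  simp only [h8]

/-! ### The Laplacian constraint on the even quartic coefficients -/

/-- From `ΔY = 0` (coefficient of `xᵢ²`, summed over `i`): `3 c_A + c_B = 0`, where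
`c_A = ∑ᵢ Y_{4eᵢ}` and `c_B = ∑_{i<j} Y_{2eᵢ+2eⱼ}`. -/
theorem quartic_trace_of_harmonic (Y : MvPolynomial (Fin 3) ℝ)
    (hΔ : ∑ i : Fin 3, MvPolynomial.pderiv i (MvPolynomial.pderiv i Y) = 0) :
    3 * (Y.coeff (Finsupp.single 0 4) + Y.coeff (Finsupp.single 1 4) +
        Y.coeff (Finsupp.single 2 4)) +
      (Y.coeff (Finsupp.single 0 2 + Finsupp.single 1 2) +
        Y.coeff (Finsupp.single 0 2 + Finsupp.single 2 2) +
        Y.coeff (Finsupp.single 1 2 + Finsupp.single 2 2)) = 0 := by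
  have h : ∀ i : Fin 3, ∑ j : Fin 3,
      Y.coeff (Finsupp.single i 2 + Finsupp.single j 1 + Finsupp.single j 1) *
      (((Finsupp.single i 2 + Finsupp.single j 1 : Fin 3 →₀ ℕ) j : ℝ) + 1) *
        (((Finsupp.single i 2 : Fin 3 →₀ ℕ) j : ℝ) + 1) = 0 := by
    intro i
    have h1 := congrArg (MvPolynomial.coeff (Finsupp.single i 2)) hΔ
    rw [MvPolynomial.coeff_sum, MvPolynomial.coeff_zero] at h1
    simp_rw [MvPolynomial.coeff_pderiv] at h1
    simpa using h1
  have h0 := h 0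
  have h1 := h 1
  have h2 := h 2
  simp only [Fin.sum_univ_three, Finsupp.add_apply, Finsupp.single_apply] at h0 h1 h2
  norm_num at h0 h1 h2
  have e1 : ∀ i : Fin 3,
      Finsupp.single i 2 + Finsupp.single i 1 + Finsupp.single i 1 = Finsupp.single i 4 := by
    intro i; rw [add_assoc, ← Finsupp.single_add, ← Finsupp.single_add]; norm_num
  have e2 : ∀ i j : Fin 3, Finsupp.single i 2 + Finsupp.single j 1 + Finsupp.single j 1 =
      Finsupp.single i 2 + Finsupp.single j 2 := by
    intro i j; rw [add_assoc, ← Finsupp.single_add]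
  have e3 : ∀ i j : Fin 3,
      Finsupp.single i 2 + Finsupp.single j 2 = Finsupp.single j 2 + Finsupp.single i 2 :=
    fun i j => add_comm _ _
  simp only [e1, e2] at h0 h1 h2
  rw [e3 1 0] at h1
  rw [e3 2 0, e3 2 1] at h2
  linarith

/-! ### Sums over the six coordinate permutations -/

/-- `∑_π v_{π⁻¹ j}^4` does not depend on `j`. -/
theorem sum_perm_pow_four_eq (v : Fin 3 → ℝ) (j : Fin 3) :
    ∑ π : Equiv.Perm (Fin 3), v (π.symm j) ^ 4 = ∑ π : Equiv.Perm (Fin 3), v (π.symm 0) ^ 4 := by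
  rw [← Equiv.sum_comp (Equiv.mulLeft (Equiv.swap (0 : Fin 3) j)) (fun π => v (π.symm 0) ^ 4)]
  refine Finset.sum_congr rfl fun π _ => ?_
  simp [Equiv.Perm.mul_def, Equiv.swap_apply_left]

/-- `∑_π v_{π⁻¹ 0}^4 = 2 ∑ᵢ vᵢ^4`. -/
theorem sum_perm_pow_four (v : Fin 3 → ℝ) :
    ∑ π : Equiv.Perm (Fin 3), v (π.symm 0) ^ 4 = 2 * ∑ i : Fin 3, v i ^ 4 := by
  have h3 : 3 * ∑ π : Equiv.Perm (Fin 3), v (π.symm 0) ^ 4 =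
      ∑ j : Fin 3, ∑ π : Equiv.Perm (Fin 3), v (π.symm j) ^ 4 := by
    simp_rw [sum_perm_pow_four_eq v]
    rw [Finset.sum_const, Finset.card_univ, Fintype.card_fin]
    simp
  have hswap : ∑ j : Fin 3, ∑ π : Equiv.Perm (Fin 3), v (π.symm j) ^ 4 =
      ∑ π : Equiv.Perm (Fin 3), ∑ j : Fin 3, v (π.symm j) ^ 4 := Finset.sum_comm
  have hinner : ∀ π : Equiv.Perm (Fin 3), ∑ j : Fin 3, v (π.symm j) ^ 4 = ∑ i : Fin 3, v i ^ 4 :=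
    fun π => Equiv.sum_comp π.symm (fun i => v i ^ 4)
  rw [hswap, Finset.sum_congr rfl fun π _ => hinner π, Finset.sum_const, Finset.card_univ,
    Fintype.card_perm, Fintype.card_fin] at h3
  norm_num [Nat.factorial] at h3
  linarith

/-- `∑_π v_{π⁻¹σ⁻¹0}² v_{π⁻¹σ⁻¹1}²` equals the `(0,1)` sum, for every permutation `σ`. -/
theorem sum_perm_sq_sq_eq (v : Fin 3 → ℝ) (σ : Equiv.Perm (Fin 3)) :
    ∑ π : Equiv.Perm (Fin 3), v (π.symm (σ.symm 0)) ^ 2 * v (π.symm (σ.symm 1)) ^ 2 =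
      ∑ π : Equiv.Perm (Fin 3), v (π.symm 0) ^ 2 * v (π.symm 1) ^ 2 := by
  rw [← Equiv.sum_comp (Equiv.mulLeft σ) (fun π => v (π.symm 0) ^ 2 * v (π.symm 1) ^ 2)]
  refine Finset.sum_congr rfl fun π _ => ?_
  simp [Equiv.Perm.mul_def]

/-- The three unordered pairs: `∑_π v_{π⁻¹0}² v_{π⁻¹2}²` and `∑_π v_{π⁻¹1}² v_{π⁻¹2}²` equal the
`(0,1)` sum. -/
theorem sum_perm_sq_sq_pairs (v : Fin 3 → ℝ) :
    ∑ π : Equiv.Perm (Fin 3), v (π.symm 0) ^ 2 * v (π.symm 2) ^ 2 =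
        ∑ π : Equiv.Perm (Fin 3), v (π.symm 0) ^ 2 * v (π.symm 1) ^ 2 ∧
      ∑ π : Equiv.Perm (Fin 3), v (π.symm 1) ^ 2 * v (π.symm 2) ^ 2 =
        ∑ π : Equiv.Perm (Fin 3), v (π.symm 0) ^ 2 * v (π.symm 1) ^ 2 := by
  have h02 := sum_perm_sq_sq_eq v (Equiv.swap 1 2)
  have h12 := sum_perm_sq_sq_eq v (Equiv.swap 0 1 * Equiv.swap 0 2)
  simp [Equiv.Perm.mul_def, Equiv.swap_apply_def] at h02 h12
  exact ⟨h02, h12⟩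

/-- `∑_π v_{π⁻¹ 0}² v_{π⁻¹ 1}² = (∑ vᵢ²)² - ∑ vᵢ⁴`. -/
theorem sum_perm_sq_sq (v : Fin 3 → ℝ) :
    ∑ π : Equiv.Perm (Fin 3), v (π.symm 0) ^ 2 * v (π.symm 1) ^ 2 =
      (∑ i : Fin 3, v i ^ 2) ^ 2 - ∑ i : Fin 3, v i ^ 4 := by
  have h01 := sum_perm_sq_sq_eq v 1
  have h02 := sum_perm_sq_sq_eq v (Equiv.swap 1 2)
  have h10 := sum_perm_sq_sq_eq v (Equiv.swap 0 1)
  have h12 := sum_perm_sq_sq_eq v (Equiv.swap 0 1 * Equiv.swap 1 2)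
  have h20 := sum_perm_sq_sq_eq v (Equiv.swap 0 2 * Equiv.swap 1 2)
  have h21 := sum_perm_sq_sq_eq v (Equiv.swap 0 2)
  simp [Equiv.Perm.mul_def, Equiv.swap_apply_def] at h01 h02 h10 h12 h20 h21
  have hinner : ∀ π : Equiv.Perm (Fin 3),
      v (π.symm 0) ^ 2 * v (π.symm 1) ^ 2 + v (π.symm 0) ^ 2 * v (π.symm 2) ^ 2 +
      v (π.symm 1) ^ 2 * v (π.symm 0) ^ 2 + v (π.symm 1) ^ 2 * v (π.symm 2) ^ 2 +
      v (π.symm 2) ^ 2 * v (π.symm 0) ^ 2 + v (π.symm 2) ^ 2 * v (π.symm 1) ^ 2 =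
        (∑ i : Fin 3, v i ^ 2) ^ 2 - ∑ i : Fin 3, v i ^ 4 := by
    intro π
    rw [← Equiv.sum_comp π.symm (fun i => v i ^ 2), ← Equiv.sum_comp π.symm (fun i => v i ^ 4)]
    simp only [Fin.sum_univ_three]
    ring
  have hsum := Finset.sum_congr rfl
    fun π (_ : π ∈ (Finset.univ : Finset (Equiv.Perm (Fin 3)))) => hinner π
  rw [Finset.sum_const, Finset.card_univ, Fintype.card_perm, Fintype.card_fin] at hsum
  simp only [Finset.sum_add_distrib] at hsum
  norm_num [Nat.factorial] at hsum
  linarith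

/-! ### The hyperoctahedral symmetrisation of a harmonic quartic -/

/-- For a harmonic homogeneous quartic `Y`, the full hyperoctahedral symmetrisation is
`40 c_A(Y) · K₄`, `K₄(v) = ∑ vᵢ⁴ - (3/5)(∑ vᵢ²)²`. -/
theorem symmetrization_of_degree_four (Y : MvPolynomial (Fin 3) ℝ) (hY : Y.IsHomogeneous 4)
    (hΔ : ∑ i : Fin 3, MvPolynomial.pderiv i (MvPolynomial.pderiv i Y) = 0) (v : Fin 3 → ℝ) :
    ∑ g ∈ (Finset.univ : Finset (Equiv.Perm (Fin 3) × (Fin 3 → ℤˣ))),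
      MvPolynomial.eval (fun i => ((g.2 i : ℤ) : ℝ) * v (g.1.symm i)) Y =
      40 * (Y.coeff (Finsupp.single 0 4) + Y.coeff (Finsupp.single 1 4) +
        Y.coeff (Finsupp.single 2 4)) *
        ((∑ i : Fin 3, v i ^ 4) - 3 / 5 * (∑ i : Fin 3, v i ^ 2) ^ 2) := by
  have htr := quartic_trace_of_harmonic Y hΔ
  rw [Fintype.sum_prod_type]
  simp only []
  have hP : ∀ π : Equiv.Perm (Fin 3),
      ∑ ε : Fin 3 → ℤˣ, MvPolynomial.eval (fun i => ((ε i : ℤ) : ℝ) * v (π.symm i)) Y = _ :=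
    fun π => sum_signs_eval_of_degree_four Y hY (fun i => v (π.symm i))
  rw [Finset.sum_congr rfl fun π _ => hP π, ← Finset.mul_sum]
  simp only [Finset.sum_add_distrib, ← Finset.mul_sum]
  rw [sum_perm_pow_four_eq v 1, sum_perm_pow_four_eq v 2, sum_perm_pow_four v,
    (sum_perm_sq_sq_pairs v).1, (sum_perm_sq_sq_pairs v).2, sum_perm_sq_sq v]
  set A0 := Y.coeff (Finsupp.single 0 4)
  set A1 := Y.coeff (Finsupp.single 1 4)
  set A2 := Y.coeff (Finsupp.single 2 4)
  set B01 := Y.coeff (Finsupp.single 0 2 + Finsupp.single 1 2)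
  set B02 := Y.coeff (Finsupp.single 0 2 + Finsupp.single 2 2)
  set B12 := Y.coeff (Finsupp.single 1 2 + Finsupp.single 2 2)
  have hB : B01 + B02 + B12 = -3 * (A0 + A1 + A2) := by linarith
  set p4 := ∑ i : Fin 3, v i ^ 4
  set p2 := ∑ i : Fin 3, v i ^ 2
  linear_combination (8 * (p2 ^ 2 - p4)) * hB

/-! ### The cubic harmonic `K₄ = ∑ xᵢ⁴ - (3/5)|x|⁴` as a polynomial -/

/-- `K₄ = ∑ᵢ Xᵢ⁴ - (3/5)(∑ᵢ Xᵢ²)²` is homogeneous of degree `4`. -/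
theorem K4poly_isHomogeneous :
    (∑ i : Fin 3, MvPolynomial.X i ^ 4 -
      MvPolynomial.C (3 / 5 : ℝ) * (∑ i : Fin 3, MvPolynomial.X i ^ 2) ^ 2 :
        MvPolynomial (Fin 3) ℝ).IsHomogeneous 4 := by
  refine MvPolynomial.IsHomogeneous.sub ?_ ?_
  · exact MvPolynomial.IsHomogeneous.sum _ _ _ fun i _ => MvPolynomial.isHomogeneous_X_pow _ _
  · have h2 : (∑ i : Fin 3, MvPolynomial.X i ^ 2 : MvPolynomial (Fin 3) ℝ).IsHomogeneous 2 :=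
      MvPolynomial.IsHomogeneous.sum _ _ _ fun i _ => MvPolynomial.isHomogeneous_X_pow _ _
    simpa using (h2.pow 2).C_mul (3 / 5 : ℝ)

/-- `K₄` is harmonic: `Δ(∑ xᵢ⁴) = 12|x|²`, `Δ|x|⁴ = 20|x|²`, `12 - (3/5)·20 = 0`. -/
theorem K4poly_harmonic :
    ∑ i : Fin 3, MvPolynomial.pderiv i (MvPolynomial.pderiv i
      (∑ i : Fin 3, MvPolynomial.X i ^ 4 -
        MvPolynomial.C (3 / 5 : ℝ) * (∑ i : Fin 3, MvPolynomial.X i ^ 2) ^ 2 :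
          MvPolynomial (Fin 3) ℝ)) = 0 := by
  have h20 : (MvPolynomial.C (3 / 5 : ℝ) : MvPolynomial (Fin 3) ℝ) * 20 = 12 := by
    rw [← map_ofNat MvPolynomial.C 20, ← MvPolynomial.C_mul, ← map_ofNat MvPolynomial.C 12]
    norm_num
  simp only [Fin.sum_univ_three, map_add, map_sub, Derivation.leibniz_pow, map_nsmul,
    smul_eq_mul, MvPolynomial.pderiv_X_self, MvPolynomial.pderiv_C, Derivation.leibniz]
  simp
  linear_combination (-(MvPolynomial.X 0 ^ 2 + MvPolynomial.X 1 ^ 2 + MvPolynomial.X 2 ^ 2 :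
    MvPolynomial (Fin 3) ℝ)) * h20

/-- Evaluation of `K₄`. -/
theorem eval_K4poly (v : Fin 3 → ℝ) :
    MvPolynomial.eval v (∑ i : Fin 3, MvPolynomial.X i ^ 4 -
      MvPolynomial.C (3 / 5 : ℝ) * (∑ i : Fin 3, MvPolynomial.X i ^ 2) ^ 2 :
        MvPolynomial (Fin 3) ℝ) = (∑ i : Fin 3, v i ^ 4) - 3 / 5 * (∑ i : Fin 3, v i ^ 2) ^ 2 := by
  simp [map_sum]

/-- `K₄` is invariant under signed coordinate permutations. -/
theorem K4_signedPerm (π : Equiv.Perm (Fin 3)) (ε : Fin 3 → ℤˣ) (v : Fin 3 → ℝ) :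
    (∑ i : Fin 3, (((ε i : ℤ) : ℝ) * v (π.symm i)) ^ 4) -
        3 / 5 * (∑ i : Fin 3, (((ε i : ℤ) : ℝ) * v (π.symm i)) ^ 2) ^ 2 =
      (∑ i : Fin 3, v i ^ 4) - 3 / 5 * (∑ i : Fin 3, v i ^ 2) ^ 2 := by
  have h4 : ∀ i, (((ε i : ℤ) : ℝ) * v (π.symm i)) ^ 4 = v (π.symm i) ^ 4 := by
    intro i; rcases Int.units_eq_one_or (ε i) with h | h <;> norm_num [h]
  have h2 : ∀ i, (((ε i : ℤ) : ℝ) * v (π.symm i)) ^ 2 = v (π.symm i) ^ 2 := by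
    intro i; rcases Int.units_eq_one_or (ε i) with h | h <;> norm_num [h]
  simp_rw [h4, h2]
  rw [Equiv.sum_comp π.symm (fun i => v i ^ 4), Equiv.sum_comp π.symm (fun i => v i ^ 2)]

end Summit.CriticalPhenomena.Ising3DConformalLimit.Theorems
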